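import Mathlib

/-!
# The tilt factors of the leaf-aligned chain (κ-family, lemmaR-A5 §22)

Kernel #221 of the solo-blind programme (audit finding F-s88-1, paper §24.112, lemmaR-A5 §22).
Writing the Kelvin modes of the leaf-aligned chain in the polarisation frame
`e₁ = (τ̂, 0)` (streak) and `e₂(m) = (-m q̂, k g^{1/2}) / |κ_m|` (roll), with
`|κ_m|² = m² + κ g`, `κ = k²` the cross-leaf tilt and `g = |V|²/V̄²` the local speed weight,
the tilt enters the chain only through the scalar factors
`c_m = m / |κ_m|`, `d_m = k g^{1/2} / |κ_m|`, the lift-up legs `P g^{1/2} / |κ_{m'}|`, the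
viscosity `K₀ (m² + κ g)` and the roll-hopping overlaps `χ_{m,m'} = c_m c_{m'} + d_m d_{m'}`
(verified against the Cartesian chain to `1e-13`, SB-C1126).  This file proves the algebra of
these factors that the two-parameter outer certificate uses:

* `c_m² + d_m² = 1`;
* the adjacent-roll overlap identity
  `χ²_{m,m+1} = (m(m+1) + x)² / ((m² + x)((m+1)² + x)) = 1 - x / ((m² + x)((m+1)² + x))`,
  `x = κ g ≥ 0`, resting on `(m(m+1) + x)² + x = (m² + x)((m+1)² + x)`;
* the UNIFORM COHERENCE BOUND `χ²_{m,m+1} ≥ 1 - 1/(2m+1)²` for every tilt, with equality exactly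
  at `x = m(m+1)` (the defect numerator is `(m(m+1) - x)²`): adjacent roll polarisations never
  decohere below `2√(m(m+1))/(2m+1)` (`≥ 2√2/3` on the first bond), at any tilt;
* monotonicity of the squared receiving factor `c_m² = m²/(m² + x)` and of the squared lift-up
  leg `1/(m² + x)` in the tilt (every first-order tilt correction weakens a roll coupling).
-/

namespace Summit.AnomalousDissipation.AnomalousDissipation.Theorems

/-- Pythagoras for the polarisation factors: `c_m² + d_m² = 1` with `c_m² = m²/(m²+x)`,
`d_m² = x/(m²+x)`, `x = κ g = k² g ≥ 0`, whenever `m² + x > 0`. -/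
theorem tilt_c_sq_add_d_sq (m x : ℝ) (h : 0 < m ^ 2 + x) :
    m ^ 2 / (m ^ 2 + x) + x / (m ^ 2 + x) = 1 := by
  rw [← add_div, div_self (ne_of_gt h)]

/-- The polynomial identity behind the adjacent overlap: `(m(m+1) + x)² + x = (m² + x)((m+1)² + x)`
(because `(m+1) - m = 1`). -/
theorem tilt_overlap_poly (m x : ℝ) :
    (m * (m + 1) + x) ^ 2 + x = (m ^ 2 + x) * ((m + 1) ^ 2 + x) := by
  ring

/-- Squared overlap of adjacent roll polarisations:
`χ² = (m(m+1)+x)² / ((m²+x)((m+1)²+x)) = 1 - x / ((m²+x)((m+1)²+x))`. -/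
theorem tilt_overlap_sq (m x : ℝ) (hm : 0 < m) (hx : 0 ≤ x) :
    (m * (m + 1) + x) ^ 2 / ((m ^ 2 + x) * ((m + 1) ^ 2 + x))
      = 1 - x / ((m ^ 2 + x) * ((m + 1) ^ 2 + x)) := by
  have hD : 0 < (m ^ 2 + x) * ((m + 1) ^ 2 + x) := by positivity
  rw [eq_sub_iff_add_eq, ← add_div, tilt_overlap_poly, div_self (ne_of_gt hD)]

/-- The overlap defect is at most `1/(2m+1)²` of unity: clearing denominators, the difference is
the square `(m(m+1) - x)²`. -/
theorem tilt_overlap_defect_poly (m x : ℝ) :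
    (2 * m + 1) ^ 2 * (m * (m + 1) + x) ^ 2
      - 4 * m * (m + 1) * ((m ^ 2 + x) * ((m + 1) ^ 2 + x))
      = (m * (m + 1) - x) ^ 2 := by
  ring

/-- UNIFORM COHERENCE of adjacent roll polarisations at every tilt:
`χ²_{m,m+1} ≥ 1 - 1/(2m+1)² = 4m(m+1)/(2m+1)²` for all `x = κ g ≥ 0`, `m > 0`. -/
theorem tilt_overlap_sq_ge (m x : ℝ) (hm : 0 < m) (hx : 0 ≤ x) :
    1 - 1 / (2 * m + 1) ^ 2
      ≤ (m * (m + 1) + x) ^ 2 / ((m ^ 2 + x) * ((m + 1) ^ 2 + x)) := by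
  have hD : 0 < (m ^ 2 + x) * ((m + 1) ^ 2 + x) := by positivity
  have hE : 0 < (2 * m + 1) ^ 2 := by positivity
  have h1 : 1 - 1 / (2 * m + 1) ^ 2 = 4 * m * (m + 1) / (2 * m + 1) ^ 2 := by
    field_simp
    ring
  rw [h1, div_le_div_iff₀ hE hD]
  nlinarith [tilt_overlap_defect_poly m x, sq_nonneg (m * (m + 1) - x)]

/-- The coherence bound is attained: at `x = m(m+1)` the squared overlap equals `1 - 1/(2m+1)²`. -/
theorem tilt_overlap_sq_min (m : ℝ) (hm : 0 < m) :
    (m * (m + 1) + m * (m + 1)) ^ 2 / ((m ^ 2 + m * (m + 1)) * ((m + 1) ^ 2 + m * (m + 1)))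
      = 1 - 1 / (2 * m + 1) ^ 2 := by
  have h2 : (2 * m + 1) ≠ 0 := by positivity
  have hm1 : m + 1 ≠ 0 := by positivity
  have hm0 : m ≠ 0 := ne_of_gt hm
  field_simp
  ring

/-- On the first bond (`m = 1`) the squared overlap is at least `8/9` (`χ ≥ 2√2/3`). -/
theorem tilt_overlap_sq_ge_first_bond (x : ℝ) (hx : 0 ≤ x) :
    8 / 9 ≤ (1 * (1 + 1) + x) ^ 2 / ((1 ^ 2 + x) * ((1 + 1) ^ 2 + x)) := by
  have h := tilt_overlap_sq_ge 1 x one_pos hx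
  norm_num at h ⊢
  linarith [h]

/-- Monotonicity of the squared receiving factor `c_m² = m²/(m²+x)` in the tilt: larger tilt,
weaker coupling. -/
theorem tilt_c_sq_antitone (m x y : ℝ) (hm : 0 < m) (hx : 0 ≤ x) (hxy : x ≤ y) :
    m ^ 2 / (m ^ 2 + y) ≤ m ^ 2 / (m ^ 2 + x) := by
  have hX : 0 < m ^ 2 + x := by positivity
  exact div_le_div_of_nonneg_left (by positivity) hX (by linarith)

/-- Monotonicity of the squared lift-up leg `1/(m'² + x)` in the tilt. -/
theorem tilt_leg_sq_antitone (m x y : ℝ) (hm : 0 < m) (hx : 0 ≤ x) (hxy : x ≤ y) :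
    1 / (m ^ 2 + y) ≤ 1 / (m ^ 2 + x) := by
  have hX : 0 < m ^ 2 + x := by positivity
  exact one_div_le_one_div_of_le hX (by linarith)

/-- First-order size of the receiving-factor defect: `1 - c_m² = x/(m²+x) ≤ x/m²`. -/
theorem tilt_c_sq_defect_le (m x : ℝ) (hm : 0 < m) (hx : 0 ≤ x) :
    1 - m ^ 2 / (m ^ 2 + x) ≤ x / m ^ 2 := by
  have hX : 0 < m ^ 2 + x := by positivity
  have hm2 : 0 < m ^ 2 := by positivity
  have h1 : 1 - m ^ 2 / (m ^ 2 + x) = x / (m ^ 2 + x) := by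
    field_simp
    ring
  rw [h1]
  exact div_le_div_of_nonneg_left hx hm2 (by linarith)

/-- First-order size of the overlap defect: `1 - χ² = x/((m²+x)((m+1)²+x)) ≤ x/(m²(m+1)²)`. -/
theorem tilt_overlap_defect_le (m x : ℝ) (hm : 0 < m) (hx : 0 ≤ x) :
    1 - (m * (m + 1) + x) ^ 2 / ((m ^ 2 + x) * ((m + 1) ^ 2 + x))
      ≤ x / (m ^ 2 * (m + 1) ^ 2) := by
  rw [tilt_overlap_sq m x hm hx, sub_sub_cancel]
  have h0 : 0 < m ^ 2 * (m + 1) ^ 2 := by positivity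
  apply div_le_div_of_nonneg_left hx h0
  nlinarith [sq_nonneg m, sq_nonneg (m + 1), mul_nonneg hx hx, mul_nonneg hx (sq_nonneg m),
    mul_nonneg hx (sq_nonneg (m + 1))]

end Summit.AnomalousDissipation.AnomalousDissipation.Theorems
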